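import Literature.Probability.Percolation.TwoSetConditionalAssociation
import Literature.Probability.Percolation.FoldingFibres
import Literature.Probability.LatticeModels.ProdBernoulliIndependence
import Summits.CriticalPhenomena.PercolationContinuityZ3.Theorems.PercNearOneGluingNoHeavyConstsHardCoreClusterStructure
import Summits.CriticalPhenomena.PercolationContinuityZ3.Theorems.PercNearOneGluingNoHeavyLowerTailQuantitativeBHKRepulsion
import Summits.CriticalPhenomena.PercolationContinuityZ3.Theorems.PercNearOneGluingNoHeavyLowerTailCovTauBridge
import Mathlib
import HarnessLib

/-!
# Two-copy BHK, II: the hard-core kernel and the averaging operator `T F = E[F | S ↮ Z(·)]` for bond percolation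

builds on p205010 (kernel theorem, internal audit signed; external expert review pending).  Support file (`--supports
stmt-CriticalPhenomena-4575`), lead seat `prim-nh-lead-4575` (gen 105); memo `run/shared/lean/prim/prim-nh-lead-4575/LEAD-GEN105.md` §1(6).
Theorems only; no sorries; standard axioms; default heartbeats.

SETTING.  `μ = prodBernoulli w` on `BondConfig V` (finite `V`), a source set `S`, a hard-core set `N`; the union cluster
`C_S ω = ⋃_{s ∈ S} C_s ω`; the HARD-CORE KERNEL `χ ω η = 1{no vertex of N is joined to S in both ω and η}` — symmetric, and
seen from `ω` it is the disconnection indicator `1{S ↮ Z(ω)}(η)` with the footprint `Z(ω) = N ∩ V(C_S ω)` (`hardCore_iff`);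
`r(ω) = μ(S ↮ Z(ω))`, `m_F(ω) = E[F; S ↮ Z(ω)]`, and the averaging operator `(T F)(ω) = E[F | S ↮ Z(ω)]`.

* `hardCore_PA` — BHK's Theorem 1.3 with the repelled set `Z(ω)` (tree: `BHK2006_setClusterConditionalPositiveAssociation`),
  in sum form: `m_F m_G ≤ m_{FG} · r` for increasing functions `F, G` of `C_S`.
* `condMean_antitone_repel` — `E[φ(C_S) | S ↮ Z'] ≤ E[φ(C_S) | S ↮ Z]` for `Z ⊆ Z'`, `φ` increasing (Theorem 1.3 with the
  decreasing cluster event `{S ↮ Z'}`).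
* `averaging_monotone_to_antitone`, `averaging_antitone_to_monotone` — when `μ(S ↮ N) > 0`, `T` maps increasing functions of
  `C_S` to decreasing ones and vice versa (`T(φ ∘ C_S) = ψ ∘ C_S`, `ψ(E) = E[φ(C_S) | S ↮ N ∩ touch(E)]`).
Part III (`…ConstsTwoCopyBHKMeasure.lean`) feeds these into the generic iteration of part I.
[cite: VandenbergHaggstromKahn2005, Thm. 1.3 (p. 6) with Remark 1 (p. 5)]
-/

noncomputable section

namespace Summit.CriticalPhenomena.PercolationContinuityZ3.Theorems

open MeasureTheory Set Literature.Probability.LatticeModels Literature.Probability.Percolation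
open Literature.Probability.Percolation.BHK2006 (weight weight_nonneg integral_prodBernoulli_eq_sum ind_mono ind_le_one)
open Literature.Probability.Percolation.DecisionTree (ind ind_of_mem ind_of_not_mem ind_nonneg)
open Literature.Probability.Percolation.TwoSetConditionalAssociation (setOf_mem_or_exists_mem_biUnion_openEdgeCluster)
open scoped Classical

namespace Consts.TwoCopy

variable {V : Type*} [Fintype V]

omit [Fintype V] in
omit [Fintype V] in
/-- **The hard-core kernel is a disconnection indicator**: `(ω, η)` is compatible (no vertex of `N` joined to `S` in both) iff
`η ∈ {S ↮ Z(ω)}`, `Z(ω) = ` the vertices of `N` joined to `S` in `ω`. [folklore] -/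
theorem hardCore_iff (S N : Set V) (ω η : BondConfig V) :
    (∀ v ∈ N, ¬ ((∃ s ∈ S, (openGraph ω).Reachable s v) ∧ (∃ s ∈ S, (openGraph η).Reachable s v))) ↔
      η ∈ {η' : BondConfig V | ∀ s ∈ S, ∀ t ∈ {v | v ∈ N ∧ ∃ s ∈ S, (openGraph ω).Reachable s v},
        ¬ (openGraph η').Reachable s t} := by
  simp only [mem_setOf_eq]
  constructor
  · intro h s hs t ⟨htN, hω⟩ hη
    exact h t htN ⟨hω, s, hs, hη⟩
  · rintro h v hvN ⟨hω, s, hs, hη⟩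
    exact h s hs v ⟨hvN, hω⟩ hη

/-- **Conditional positive association seen from every `ω`** (BHK's Theorem 1.3 with the repelled set `Z(ω)`, in sum form):
for monotone `φ, ψ` of the union cluster, `m_F(ω) m_G(ω) ≤ m_{FG}(ω) r(ω)` with the hard-core kernel.
[cite: VandenbergHaggstromKahn2005, Thm. 1.3 (p. 6) with Remark 1 (p. 5)] -/
theorem hardCore_PA (w : Sym2 V → unitInterval) (S N : Set V) (χ : BondConfig V → BondConfig V → ℝ)
    (hχ : ∀ ω η, χ ω η = if (∀ v ∈ N, ¬ ((∃ s ∈ S, (openGraph ω).Reachable s v) ∧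
      (∃ s ∈ S, (openGraph η).Reachable s v))) then 1 else 0)
    (φ ψ : Set (Sym2 V) → ℝ) (hφ : Monotone φ) (hψ : Monotone ψ) (ω : BondConfig V) :
    (∑ η, weight (fun e => (w e : ℝ)) η * (φ (⋃ s ∈ S, openEdgeCluster η s) * χ ω η)) *
        (∑ η, weight (fun e => (w e : ℝ)) η * (ψ (⋃ s ∈ S, openEdgeCluster η s) * χ ω η)) ≤
      (∑ η, weight (fun e => (w e : ℝ)) η *
          (φ (⋃ s ∈ S, openEdgeCluster η s) * ψ (⋃ s ∈ S, openEdgeCluster η s) * χ ω η)) *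
        (∑ η, weight (fun e => (w e : ℝ)) η * χ ω η) := by
  set Z : Set V := {v | v ∈ N ∧ ∃ s ∈ S, (openGraph ω).Reachable s v} with hZ
  set D : Set (BondConfig V) := {η' : BondConfig V | ∀ s ∈ S, ∀ t ∈ Z, ¬ (openGraph η').Reachable s t} with hD
  have hχD : ∀ η, χ ω η = ind D η := fun η => by
    rw [hχ]
    by_cases h : η ∈ D
    · rw [ind_of_mem h, if_pos ((hardCore_iff S N ω η).2 h)]
    · rw [ind_of_not_mem h, if_neg (fun h' => h ((hardCore_iff S N ω η).1 h'))]
  have key := BHK2006_setClusterConditionalPositiveAssociation w S Z φ ψ hφ hψ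
  rw [QuantBHK.setIntegral_eq_sum_weight, QuantBHK.setIntegral_eq_sum_weight, QuantBHK.setIntegral_eq_sum_weight,
    prodBernoulli_real_eq_sum_weight_ind] at key
  simp only [hχD]
  calc (∑ η, weight (fun e => (w e : ℝ)) η * (φ (⋃ s ∈ S, openEdgeCluster η s) * ind D η)) *
        (∑ η, weight (fun e => (w e : ℝ)) η * (ψ (⋃ s ∈ S, openEdgeCluster η s) * ind D η))
      ≤ (∑ η, weight (fun e => (w e : ℝ)) η * ind D η) *
          (∑ η, weight (fun e => (w e : ℝ)) η *
            (φ (⋃ s ∈ S, openEdgeCluster η s) * ψ (⋃ s ∈ S, openEdgeCluster η s) * ind D η)) := key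
    _ = _ := by ring

omit [Fintype V] in
/-- Disconnection events `{S ↮ Z}` are decreasing. [folklore] -/
theorem isLowerSet_notReachable (S Z : Set V) :
    IsLowerSet {η : BondConfig V | ∀ s ∈ S, ∀ t ∈ Z, ¬ (openGraph η).Reachable s t} :=
  fun _ _ hle hη s hs t ht hr => hη s hs t ht (hr.mono (openGraph_mono hle))

omit [Fintype V] in
/-- `{S ↮ Z'} ⊆ {S ↮ Z}` for `Z ⊆ Z'`. [folklore] -/
theorem notReachable_antitone (S : Set V) {Z Z' : Set V} (h : Z ⊆ Z') :
    {η : BondConfig V | ∀ s ∈ S, ∀ t ∈ Z', ¬ (openGraph η).Reachable s t} ⊆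
      {η : BondConfig V | ∀ s ∈ S, ∀ t ∈ Z, ¬ (openGraph η).Reachable s t} :=
  fun _ hη s hs t ht => hη s hs t (h ht)

omit [Fintype V] in
/-- `1_{D'} · 1_D = 1_{D'}` for `D' ⊆ D`. [folklore] -/
theorem ind_mul_ind_of_subset {D D' : Set (BondConfig V)} (h : D' ⊆ D) (η : BondConfig V) :
    ind D' η * ind D η = ind D' η := by
  by_cases hη : η ∈ D'
  · rw [ind_of_mem hη, ind_of_mem (h hη), one_mul]
  · rw [ind_of_not_mem hη, zero_mul]

/-- **Conditional means of increasing cluster functions decrease with the repelled set** (BHK's Theorem 1.3, increasing/decreasing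
form, with the decreasing cluster event `{S ↮ Z' ∖ Z}`): for `Z ⊆ Z'` and monotone `φ`,
`E[φ(C_S) | S ↮ Z'] ≤ E[φ(C_S) | S ↮ Z]`. [cite: VandenbergHaggstromKahn2005, Thm. 1.3 (p. 6, last sentence)] -/
theorem condMean_antitone_repel (w : Sym2 V → unitInterval) (S : Set V) {Z Z' : Set V} (hZZ' : Z ⊆ Z')
    (φ : Set (Sym2 V) → ℝ) (hφ : Monotone φ)
    (hpos : 0 < ∑ η, weight (fun e => (w e : ℝ)) η *
      ind {η' : BondConfig V | ∀ s ∈ S, ∀ t ∈ Z', ¬ (openGraph η').Reachable s t} η) :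
    (∑ η, weight (fun e => (w e : ℝ)) η * (φ (⋃ s ∈ S, openEdgeCluster η s) *
        ind {η' : BondConfig V | ∀ s ∈ S, ∀ t ∈ Z', ¬ (openGraph η').Reachable s t} η)) /
      (∑ η, weight (fun e => (w e : ℝ)) η *
        ind {η' : BondConfig V | ∀ s ∈ S, ∀ t ∈ Z', ¬ (openGraph η').Reachable s t} η) ≤
    (∑ η, weight (fun e => (w e : ℝ)) η * (φ (⋃ s ∈ S, openEdgeCluster η s) *
        ind {η' : BondConfig V | ∀ s ∈ S, ∀ t ∈ Z, ¬ (openGraph η').Reachable s t} η)) /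
      (∑ η, weight (fun e => (w e : ℝ)) η *
        ind {η' : BondConfig V | ∀ s ∈ S, ∀ t ∈ Z, ¬ (openGraph η').Reachable s t} η) := by
  set D : Set (BondConfig V) := {η' : BondConfig V | ∀ s ∈ S, ∀ t ∈ Z, ¬ (openGraph η').Reachable s t} with hD
  set D' : Set (BondConfig V) := {η' : BondConfig V | ∀ s ∈ S, ∀ t ∈ Z', ¬ (openGraph η').Reachable s t} with hD'
  have hD'D : D' ⊆ D := notReachable_antitone S hZZ'
  -- the decreasing cluster function `g = 1_{S ↮ Z'}` read off `C_S`
  set g : Set (Sym2 V) → ℝ := fun E => if (∀ t ∈ Z', ¬ (t ∈ S ∨ ∃ e ∈ E, t ∈ e)) then 1 else 0 with hg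
  have hg_anti : Antitone g := by
    intro E E' hEE'
    simp only [hg]
    by_cases h' : ∀ t ∈ Z', ¬ (t ∈ S ∨ ∃ e ∈ E', t ∈ e)
    · have h : ∀ t ∈ Z', ¬ (t ∈ S ∨ ∃ e ∈ E, t ∈ e) := fun t ht hor =>
        h' t ht (hor.imp_right fun ⟨e, he, hte⟩ => ⟨e, hEE' he, hte⟩)
      rw [if_pos h', if_pos h]
    · rw [if_neg h']
      split_ifs <;> norm_num
  have hgC : ∀ η : BondConfig V, g (⋃ s ∈ S, openEdgeCluster η s) = ind D' η := by
    intro η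
    by_cases hη : η ∈ D'
    · have h : ∀ t ∈ Z', ¬ (t ∈ S ∨ ∃ e ∈ ⋃ s ∈ S, openEdgeCluster η s, t ∈ e) := fun t ht hor => by
        obtain ⟨s, hs, hr⟩ := (TwoCopyHardCore.exists_reachable_iff_cluster S η t).2 hor
        exact hη s hs t ht hr
      rw [ind_of_mem hη]
      simp only [hg, if_pos h]
    · have h : ¬ ∀ t ∈ Z', ¬ (t ∈ S ∨ ∃ e ∈ ⋃ s ∈ S, openEdgeCluster η s, t ∈ e) := fun h =>
        hη fun s hs t ht hr => h t ht ((TwoCopyHardCore.exists_reachable_iff_cluster S η t).1 ⟨s, hs, hr⟩)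
      rw [ind_of_not_mem hη]
      simp only [hg, if_neg h]
  have key := BHK2006_setClusterConditionalPositiveAssociation w S Z φ (fun E => -g E) hφ
    (fun _ _ hab => neg_le_neg (hg_anti hab))
  rw [QuantBHK.setIntegral_eq_sum_weight, QuantBHK.setIntegral_eq_sum_weight, QuantBHK.setIntegral_eq_sum_weight,
    prodBernoulli_real_eq_sum_weight_ind] at key
  have e1 : ∑ η, weight (fun e => (w e : ℝ)) η * (-g (⋃ s ∈ S, openEdgeCluster η s) * ind D η) =
      -∑ η, weight (fun e => (w e : ℝ)) η * ind D' η := by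
    rw [← Finset.sum_neg_distrib]
    exact Finset.sum_congr rfl fun η _ => by rw [hgC, neg_mul, ind_mul_ind_of_subset hD'D]; ring
  have e2 : ∑ η, weight (fun e => (w e : ℝ)) η *
        (φ (⋃ s ∈ S, openEdgeCluster η s) * -g (⋃ s ∈ S, openEdgeCluster η s) * ind D η) =
      -∑ η, weight (fun e => (w e : ℝ)) η * (φ (⋃ s ∈ S, openEdgeCluster η s) * ind D' η) := by
    rw [← Finset.sum_neg_distrib]
    exact Finset.sum_congr rfl fun η _ => by rw [hgC, mul_assoc, neg_mul, ind_mul_ind_of_subset hD'D]; ring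
  rw [e1, e2] at key
  have hpos' : 0 < ∑ η, weight (fun e => (w e : ℝ)) η * ind D η :=
    hpos.trans_le (Finset.sum_le_sum fun η _ => mul_le_mul_of_nonneg_left
      (ind_mono hD'D η) (weight_nonneg (fun e => (w e).2.1) (fun e => (w e).2.2) η))
  rw [div_le_div_iff₀ hpos hpos']
  nlinarith [key]

/-- **The averaging operator maps increasing cluster functions to decreasing ones.**  With the hard-core kernel `χ`,
`δ = μ(S ↮ N) > 0` and `(T X) ω · r(ω) = m_X(ω)`: for monotone `φ`, `T (φ ∘ C_S) = ψ ∘ C_S` with `ψ` antitone, namely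
`ψ(E) = E[φ(C_S) | S ↮ N ∩ touch(E)]`. [cite: VandenbergHaggstromKahn2005, Thm. 1.3 (p. 6)] -/
theorem averaging_monotone_to_antitone (w : Sym2 V → unitInterval) (S N : Set V)
    (χ : BondConfig V → BondConfig V → ℝ)
    (hχ : ∀ ω η, χ ω η = if (∀ v ∈ N, ¬ ((∃ s ∈ S, (openGraph ω).Reachable s v) ∧
      (∃ s ∈ S, (openGraph η).Reachable s v))) then 1 else 0)
    (hδ : 0 < ∑ η, weight (fun e => (w e : ℝ)) η *
      ind {η' : BondConfig V | ∀ s ∈ S, ∀ t ∈ N, ¬ (openGraph η').Reachable s t} η)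
    (T : (BondConfig V → ℝ) → BondConfig V → ℝ)
    (hT : ∀ (X : BondConfig V → ℝ) ω, T X ω * (∑ η, weight (fun e => (w e : ℝ)) η * χ ω η) =
      ∑ η, weight (fun e => (w e : ℝ)) η * (X η * χ ω η))
    (φ : Set (Sym2 V) → ℝ) (hφ : Monotone φ) :
    ∃ ψ : Set (Sym2 V) → ℝ, Antitone ψ ∧
      T (fun η => φ (⋃ s ∈ S, openEdgeCluster η s)) = fun ω => ψ (⋃ s ∈ S, openEdgeCluster ω s) := by
  -- the footprint of an edge set in `N`, and the conditional mean given avoidance of it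
  refine ⟨fun E => (∑ η, weight (fun e => (w e : ℝ)) η * (φ (⋃ s ∈ S, openEdgeCluster η s) *
      ind {η' : BondConfig V | ∀ s ∈ S, ∀ t ∈ N ∩ {v | v ∈ S ∨ ∃ e ∈ E, v ∈ e},
        ¬ (openGraph η').Reachable s t} η)) /
      (∑ η, weight (fun e => (w e : ℝ)) η *
        ind {η' : BondConfig V | ∀ s ∈ S, ∀ t ∈ N ∩ {v | v ∈ S ∨ ∃ e ∈ E, v ∈ e},
          ¬ (openGraph η').Reachable s t} η), ?_, ?_⟩
  · -- antitone: a larger edge set touches more of `N`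
    intro E E' hEE'
    have hsub : N ∩ {v | v ∈ S ∨ ∃ e ∈ E, v ∈ e} ⊆ N ∩ {v | v ∈ S ∨ ∃ e ∈ E', v ∈ e} :=
      Set.inter_subset_inter_right N fun v hv => hv.imp_right fun ⟨e, he, hve⟩ => ⟨e, hEE' he, hve⟩
    refine condMean_antitone_repel w S hsub φ hφ (hδ.trans_le ?_)
    exact Finset.sum_le_sum fun η _ => mul_le_mul_of_nonneg_left
      (ind_mono (notReachable_antitone S Set.inter_subset_left) η)
      (weight_nonneg (fun e => (w e).2.1) (fun e => (w e).2.2) η)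
  · -- `T F ω` is this conditional mean at `E = C_S(ω)`
    funext ω
    set Zω : Set V := N ∩ {v | v ∈ S ∨ ∃ e ∈ ⋃ s ∈ S, openEdgeCluster ω s, v ∈ e} with hZω
    have hχD : ∀ η, χ ω η = ind {η' : BondConfig V | ∀ s ∈ S, ∀ t ∈ Zω, ¬ (openGraph η').Reachable s t} η := by
      intro η
      have hZeq : {v | v ∈ N ∧ ∃ s ∈ S, (openGraph ω).Reachable s v} = Zω := by
        ext v
        simp only [hZω, mem_setOf_eq, mem_inter_iff, TwoCopyHardCore.exists_reachable_iff_cluster S ω v]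
      rw [hχ]
      by_cases h : η ∈ {η' : BondConfig V | ∀ s ∈ S, ∀ t ∈ Zω, ¬ (openGraph η').Reachable s t}
      · rw [ind_of_mem h, if_pos ((hardCore_iff S N ω η).2 (hZeq ▸ h))]
      · rw [ind_of_not_mem h, if_neg (fun h' => h (hZeq ▸ (hardCore_iff S N ω η).1 h'))]
    have hr : 0 < ∑ η, weight (fun e => (w e : ℝ)) η * χ ω η := by
      refine hδ.trans_le (Finset.sum_le_sum fun η _ => mul_le_mul_of_nonneg_left ?_
        (weight_nonneg (fun e => (w e).2.1) (fun e => (w e).2.2) η))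
      rw [hχD]
      exact ind_mono (notReachable_antitone S Set.inter_subset_left) η
    have hTω := hT (fun η => φ (⋃ s ∈ S, openEdgeCluster η s)) ω
    rw [eq_div_iff (hr.trans_le (le_of_eq ?_)).ne']
    · rw [show (∑ η, weight (fun e => (w e : ℝ)) η *
          ind {η' : BondConfig V | ∀ s ∈ S, ∀ t ∈ Zω, ¬ (openGraph η').Reachable s t} η) =
          ∑ η, weight (fun e => (w e : ℝ)) η * χ ω η from Finset.sum_congr rfl fun η _ => by rw [hχD],
        hTω]
      exact Finset.sum_congr rfl fun η _ => by rw [hχD]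
    · exact Finset.sum_congr rfl fun η _ => by rw [hχD]

/-- The disconnection indicator `1_{S ↮ N}` lies below the hard-core kernel: a copy avoiding `N` is compatible with everything.
[folklore] -/
theorem ind_notReachable_le_kernel (S N : Set V) (χ : BondConfig V → BondConfig V → ℝ)
    (hχ : ∀ ω η, χ ω η = if (∀ v ∈ N, ¬ ((∃ s ∈ S, (openGraph ω).Reachable s v) ∧
      (∃ s ∈ S, (openGraph η).Reachable s v))) then 1 else 0) (ω η : BondConfig V) :
    ind {η' : BondConfig V | ∀ s ∈ S, ∀ t ∈ N, ¬ (openGraph η').Reachable s t} η ≤ χ ω η := by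
  rw [hχ]
  by_cases hη : η ∈ {η' : BondConfig V | ∀ s ∈ S, ∀ t ∈ N, ¬ (openGraph η').Reachable s t}
  · rw [ind_of_mem hη, if_pos]
    rintro v hv ⟨-, s, hs, hr⟩
    exact hη s hs v hv hr
  · rw [ind_of_not_mem hη]
    split_ifs <;> norm_num

/-- The hard-core kernel is symmetric and `{0,1}`-valued. [folklore] -/
theorem kernel_symm_le_one (S N : Set V) (χ : BondConfig V → BondConfig V → ℝ)
    (hχ : ∀ ω η, χ ω η = if (∀ v ∈ N, ¬ ((∃ s ∈ S, (openGraph ω).Reachable s v) ∧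
      (∃ s ∈ S, (openGraph η).Reachable s v))) then 1 else 0) (ω η : BondConfig V) :
    χ ω η = χ η ω ∧ χ ω η ≤ 1 := by
  constructor
  · rw [hχ, hχ]
    simp only [and_comm]
  · rw [hχ]
    split_ifs <;> norm_num

/-- **The averaging operator maps decreasing cluster functions to increasing ones** (from the increasing case applied to `−φ`).
[cite: VandenbergHaggstromKahn2005, Thm. 1.3 (p. 6)] -/
theorem averaging_antitone_to_monotone (w : Sym2 V → unitInterval) (S N : Set V)
    (χ : BondConfig V → BondConfig V → ℝ)
    (hχ : ∀ ω η, χ ω η = if (∀ v ∈ N, ¬ ((∃ s ∈ S, (openGraph ω).Reachable s v) ∧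
      (∃ s ∈ S, (openGraph η).Reachable s v))) then 1 else 0)
    (hδ : 0 < ∑ η, weight (fun e => (w e : ℝ)) η *
      ind {η' : BondConfig V | ∀ s ∈ S, ∀ t ∈ N, ¬ (openGraph η').Reachable s t} η)
    (T : (BondConfig V → ℝ) → BondConfig V → ℝ)
    (hT : ∀ (X : BondConfig V → ℝ) ω, T X ω * (∑ η, weight (fun e => (w e : ℝ)) η * χ ω η) =
      ∑ η, weight (fun e => (w e : ℝ)) η * (X η * χ ω η))
    (φ : Set (Sym2 V) → ℝ) (hφ : Antitone φ) :
    ∃ ψ : Set (Sym2 V) → ℝ, Monotone ψ ∧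
      T (fun η => φ (⋃ s ∈ S, openEdgeCluster η s)) = fun ω => ψ (⋃ s ∈ S, openEdgeCluster ω s) := by
  obtain ⟨ψ, hψ, hTψ⟩ := averaging_monotone_to_antitone w S N χ hχ hδ T hT (fun E => -φ E)
    (fun _ _ hab => neg_le_neg (hφ hab))
  refine ⟨fun E => -ψ E, fun _ _ hab => neg_le_neg (hψ hab), funext fun ω => ?_⟩
  have hr : 0 < ∑ η, weight (fun e => (w e : ℝ)) η * χ ω η :=
    hδ.trans_le (Finset.sum_le_sum fun η _ => mul_le_mul_of_nonneg_left
      (ind_notReachable_le_kernel S N χ hχ ω η) (weight_nonneg (fun e => (w e).2.1) (fun e => (w e).2.2) η))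
  have h1 := hT (fun η => φ (⋃ s ∈ S, openEdgeCluster η s)) ω
  have h2 := hT (fun η => -φ (⋃ s ∈ S, openEdgeCluster η s)) ω
  rw [hTψ] at h2
  have hsum : ∑ η, weight (fun e => (w e : ℝ)) η * (-φ (⋃ s ∈ S, openEdgeCluster η s) * χ ω η) =
      -∑ η, weight (fun e => (w e : ℝ)) η * (φ (⋃ s ∈ S, openEdgeCluster η s) * χ ω η) := by
    rw [← Finset.sum_neg_distrib]
    exact Finset.sum_congr rfl fun η _ => by ring
  rw [hsum, ← h1] at h2
  -- `ψ(C ω) · r = −(T F ω · r)` with `r > 0`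
  have : (T (fun η => φ (⋃ s ∈ S, openEdgeCluster η s)) ω + ψ (⋃ s ∈ S, openEdgeCluster ω s)) *
      (∑ η, weight (fun e => (w e : ℝ)) η * χ ω η) = 0 := by
    rw [add_mul, h2]; ring
  have h0 := (mul_eq_zero.1 this).resolve_right hr.ne'
  linarith

end Consts.TwoCopy

end Summit.CriticalPhenomena.PercolationContinuityZ3.Theorems

end
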